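/-
Copyright (c) 2026 the pub-hodgecm-mathlib formalisation cell (harness21).  Prover seat hodgecm-mathlib-LH3-p02 (g4): line LH3 (closer stub `stub_N9`), LETTER L1 clause (I₁),
organ O-L1c FACES — the HYPOTHESIS-FREE payment of (F₀)+(F′-a) «faces off the real walls» (LH3-plan (g4) RULING #18 (F′) CUT 2; (H-core) PART 1 ★ p851249, LH5-p02 (g4)).
-/
import Literature.NumberTheory.Rogawski1990.ArchOrbFamGExtFaceJetRelabel       -- ★ p851233∕p851240 (this seat): `exists_nhds_bddAbove_norm_iteratedFDeriv_orbFamGExt_of_hcSwapAt`, the frame∕carrier plumbing names; brings ★ `…_of_boxPackage` (p851220)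
import Literature.NumberTheory.Rogawski1990.ArchOrbFamGExtBoxDescentInRegG     -- ★ p851168 (LH7-p02 (g4)): (B-desc′) dock `exists_descent_box_orbFamGExt_inRegG_of_corePackage`
import Literature.NumberTheory.Rogawski1990.ArchOrbFamGExtBoxDescentInRegAt    -- ★ p851249 (LH5-p02 (g4)): (H-core) PART 1 `exists_descent_box_orbFamG_corePackage_of_wall_inRegAt` (one-wall base points OFF THE REAL WALLS)
import Literature.NumberTheory.Rogawski1990.ArchOrbFamGExtBoxDescentFaces     -- ★ p851313 (LH5-p02 (g4)): (H-core) L3 HEAD `exists_descent_box_orbFamGExt_inRegG` at EVERY one-wall point — EDITION 4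
import HarnessLib

/-!
# (I₁) AT THE FACES OFF THE REAL WALLS — HYPOTHESIS-FREE: locally bounded jets of `orbFamGExt` near every one-wall point whose split coordinates are off their real walls
# (Harish-Chandra ∕ Varadarajan 1977 I §1.12; Bouaziz 1994 §3.1–3.2; Shelstad 1979 §4; Rogawski 1990 §8.2)

Topic `NumberTheory/Rogawski1990`; namespace `Literature.NumberTheory.Rogawski1990`.  THEOREMS ONLY (no `def`, no instance, no notation, no axiom, no named fact, no `sorry`).
Cell `pub/hodgecm-mathlib`, crux H413 (`stmt-HodgeConjecture-24833`), F0∕P3c line LH3 (closer stub `stub_N9`, DIRECT ROAD, leaf v5.1 `F0_P3c_StubN9Direct`), LETTER L1 clause (I₁),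
organ **O-L1c `stub_N9hcFaceJetBounds` = `hF`** of ★ `smoothBounded_orbFamGExt_of_strata₄`: its sub-stratum **(F₀)+(F′-a) «faces whose split coordinates are off the real walls»**
(every `HcSemireg` face and every non-generic one-wall point with `x_w 0 ≠ 0` at the split places `w ∈ S′`) — PAID HERE WITHOUT HYPOTHESES; the complement **(F′-b) «one
noncompact wall × a real wall»** is LH5-p02 (g4)'s booked brick (11:20:28Z; the `Z(γ_p)`-descent has a noncompact centraliser there).  Seat LH3-p02 (g4).

THE ASSEMBLY (nothing re-derived): §1 `faceJetBounds_of_wall02_of_invariant` — the predicate-generic twin of ★ `faceJetBounds_of_wall02` (p851233 §4): the socket reduction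
to the `(0,2)`-heads carries along any property `P S′ x` of the base point that the compact reflection `hcSwapAt w 0 1` (`w ∉ S′`) preserves — here `P S′ x :≡ ∀ w′ ∈ S′, x w′ 0 ≠ 0`
(the reflection does not touch the places `w′ ≠ w`).  §2 **`faceJetBounds_offRealWalls (hherm) (hanis) (ha′)`** — the body of the leaf's `HcFaceJetBoundsStatement` with ONE extra
hypothesis `(∀ w′ ∈ S′, x w′ 0 ≠ 0)`: §1 ∘ ★ `exists_nhds_bddAbove_norm_iteratedFDeriv_orbFamGExt_of_boxPackage` (p851220) ∘ ★ (B-desc′) dock `…_of_corePackage` (p851168) ∘ ★ (H-core)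
PART 1 `exists_descent_box_orbFamG_corePackage_of_wall_inRegAt` (p851249), the Cayley carrier `U(Φ₂ ⊗ ℂ)` and a two-sided Haar `μ₀` built inside (★ `sharedRankOneDatum_exists`).
HONEST LABEL: (F′-b) open (LH5-p02); HC_CM is proved only modulo the 7 printed citations (2 remaining: hLiu418 = `stmt-HodgeConjecture-24832`, h413 = `stmt-HodgeConjecture-24833`)
until rung 0 closes; count-neutral letter-L1 (I₁) plumbing.

## References
* [Varadarajan1977] V. S. Varadarajan, *Harmonic Analysis on Real Reductive Groups*, LNM 576 (1977), Part I §1.12.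
* [Bouaziz1994IntegralesOrbitales] A. Bouaziz, *Intégrales orbitales sur les groupes de Lie réductifs*, Ann. Sci. ÉNS 27 (1994), §3.1 (I₁)–(I₂) p. 579, §3.2 p. 580.
* [Shelstad1979] D. Shelstad, *Characters and inner forms of a quasi-split group over ℝ*, Compositio Math. 39 (1979), §4 pp. 22–25.
* [Rogawski1990] J. D. Rogawski, *Automorphic Representations of Unitary Groups in Three Variables*, Ann. of Math. Stud. 123 (1990), §8.2 pp. 118–124.
-/

set_option autoImplicit false

noncomputable section

open Set Filter Topology Function MeasureTheory NumberField NumberField.InfinitePlace Complex Equiv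
open scoped ContDiff MatrixGroups Matrix Classical Real Matrix.Norms.Operator

namespace Literature.NumberTheory.Rogawski1990

open Literature.NumberTheory.Automorphic Literature.NumberTheory.Automorphic.UnitaryGroup Literature.NumberTheory.Automorphic.ArchCartan
open Literature.Analysis.Calculus

variable (L : Type) [Field L] [NumberField L] [IsCMField L] (α : Fin 3 → L)
  [MeasurableSpace ↥(arch (↥(maximalRealSubfield L)) L (IsCMField.complexConj L) 3 (Matrix.diagonal α))]
  [BorelSpace ↥(arch (↥(maximalRealSubfield L)) L (IsCMField.complexConj L) 3 (Matrix.diagonal α))]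
  (ν' : Measure ↥(arch (↥(maximalRealSubfield L)) L (IsCMField.complexConj L) 3 (Matrix.diagonal α))) [ν'.IsHaarMeasure] [ν'.IsMulRightInvariant]

/-! ## §1 The socket reduction carrying a reflection-invariant property of the base point -/

/-- **THE `hF` SOCKET FROM THE `(0,2)`-HEADS, RELATIVE TO A REFLECTION-INVARIANT PROPERTY `P`** (twin of ★ `faceJetBounds_of_wall02`): if the compact reflection `hcSwapAt w 0 1`
(`w ∉ S′`) preserves `P S′`, and the `(0,2)`-heads hold at the admissible labels for the base points with `P`, then the whole face socket holds for the base points with `P`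
(junk labels ★ `orbFamGExt_of_not_admissible`; slot signs `(s,s,−s)` ★ `slotSign_of_mem_splitChartPlaces`; `(1,2)∕(2,1)` reflected onto `(0,2)` by ★ `…_orbFamGExt_of_hcSwapAt`).
[cite: Shelstad1979, §4 property (II) p. 23; Lemma 4.3 (p. 25)] [cite: Varadarajan1977, Part I §1.12] [cite: Bouaziz1994IntegralesOrbitales, §3.1 (I₁)–(I₂) p. 579; §3.2 p. 580] -/
theorem faceJetBounds_of_wall02_of_invariant (hα : ∀ i, α i ≠ 0)
    (hreal : ∀ (w : {w : InfinitePlace L // IsComplex w}) (i : Fin 3), (w.1.embedding (α i)).im = 0)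
    {a' : ↥(arch (↥(maximalRealSubfield L)) L (IsCMField.complexConj L) 3 (Matrix.diagonal α)) → ℂ} (ha' : ArchSmooth L 3 (Matrix.diagonal α) a')
    (P : Finset {w : InfinitePlace L // IsComplex w} → ({w : InfinitePlace L // IsComplex w} → Fin 3 → ℝ) → Prop) (hP : ∀ (S' : Finset {w : InfinitePlace L // IsComplex w}) (w : {w : InfinitePlace L // IsComplex w}), w ∉ S' → ∀ x : {w : InfinitePlace L // IsComplex w} → Fin 3 → ℝ, P S' x → P S' (hcSwapAt w 0 1 x))
    (h02 : ∀ (S' : Finset {w : InfinitePlace L // IsComplex w}), (∀ w, w ∈ S' → w ∈ splitChartPlaces L α) → ∀ (n : ℕ) (x : {w : InfinitePlace L // IsComplex w} → Fin 3 → ℝ) (w : {w : InfinitePlace L // IsComplex w}), w ∉ S' →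
      slotSign L α w 0 ≠ slotSign L α w 2 → x w 0 = x w 2 → Circle.exp (x w (hcThird 0 2)) ≠ Circle.exp (x w 0) →
      (∀ w', w' ∉ S' → w' ≠ w → ∀ i' j' : Fin 3, i' ≠ j' → slotSign L α w' i' ≠ slotSign L α w' j' → Circle.exp (x w' i') ≠ Circle.exp (x w' j')) → P S' x →
      ∃ U ∈ 𝓝 x, BddAbove ((fun c => ‖iteratedFDeriv ℝ n (orbFamGExt L α ν' a' S') c‖) '' (U ∩ InRegG (slotSign L α) S'))) :
    ∀ (S' : Finset {w : InfinitePlace L // IsComplex w}) (n : ℕ) (x : {w : InfinitePlace L // IsComplex w} → Fin 3 → ℝ) (w : {w : InfinitePlace L // IsComplex w}) (i j : Fin 3),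
      (∀ w' : {w : InfinitePlace L // IsComplex w}, w' ∉ S' → ∀ l : Fin 3, x w' l ∈ Ico 0 (2 * π)) →
      w ∉ S' → i ≠ j → slotSign L α w i ≠ slotSign L α w j → x w i = x w j →
        Circle.exp (x w (hcThird i j)) ≠ Circle.exp (x w i) →
        (∀ w', w' ∉ S' → w' ≠ w → ∀ i' j' : Fin 3, i' ≠ j' → slotSign L α w' i' ≠ slotSign L α w' j' → Circle.exp (x w' i') ≠ Circle.exp (x w' j')) →
        P S' x →
        ∃ U ∈ 𝓝 x, BddAbove ((fun c => ‖iteratedFDeriv ℝ n (orbFamGExt L α ν' a' S') c‖) '' (U ∩ InRegG (slotSign L α) S')) := by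
  intro S' n x w i j _ hw hij hsij hx hxk hxin hPx
  by_cases hS' : ∀ w, w ∈ S' → w ∈ splitChartPlaces L α
  swap
  · -- junk label: the family vanishes
    refine ⟨univ, univ_mem, 0, ?_⟩
    rintro _ ⟨c, -, rfl⟩
    show ‖iteratedFDeriv ℝ n (orbFamGExt L α ν' a' S') c‖ ≤ 0
    rw [orbFamGExt_of_not_admissible L α ν' a' S' hS', iteratedFDeriv_fun_zero, Pi.zero_apply, norm_zero]
  -- admissible label: the place is a split-chart place, slot signs `(s, s, −s)`
  have hind : IsIndefiniteAt (slotSign L α) w := by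
    intro hdef
    have h0 : ∀ l : Fin 3, slotSign L α w l = slotSign L α w 0 := by
      intro l
      fin_cases l
      · rfl
      · exact hdef.1.symm
      · exact hdef.2.symm.trans hdef.1.symm
    exact hsij (by rw [h0 i, h0 j])
  have hwsp : w ∈ splitChartPlaces L α := mem_splitChartPlaces_of_isIndefiniteAt L α hα (hreal w) hind
  obtain ⟨h10, -, -⟩ := slotSign_of_mem_splitChartPlaces L α hα hwsp
  have h02s : slotSign L α w 0 ≠ slotSign L α w 2 := (slotSign_zero_ne_two_of_mem_splitChartPlaces L α hα hwsp).1
  -- the `(0,2)`-head at any one-wall point `y` with `P`, all orders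
  have hA : ∀ y : {w : InfinitePlace L // IsComplex w} → Fin 3 → ℝ, y w 0 = y w 2 → Circle.exp (y w 1) ≠ Circle.exp (y w 0) →
      (∀ w', w' ∉ S' → w' ≠ w → ∀ i' j' : Fin 3, i' ≠ j' → slotSign L α w' i' ≠ slotSign L α w' j' → Circle.exp (y w' i') ≠ Circle.exp (y w' j')) → P S' y →
      ∀ m : ℕ, ∃ U ∈ 𝓝 y, BddAbove ((fun c => ‖iteratedFDeriv ℝ m (orbFamGExt L α ν' a' S') c‖) '' (U ∩ InRegG (slotSign L α) S')) := fun y hy hyk hyin hPy m =>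
    h02 S' hS' m y w hw h02s hy (by rwa [hcThird_zero_two]) hyin hPy
  -- the `(1,2)`-wall: reflect by `hcSwapAt w 0 1` onto the `(0,2)`-wall (`P` is preserved)
  have hB : ∀ y : {w : InfinitePlace L // IsComplex w} → Fin 3 → ℝ, y w 1 = y w 2 → Circle.exp (y w 0) ≠ Circle.exp (y w 1) →
      (∀ w', w' ∉ S' → w' ≠ w → ∀ i' j' : Fin 3, i' ≠ j' → slotSign L α w' i' ≠ slotSign L α w' j' → Circle.exp (y w' i') ≠ Circle.exp (y w' j')) → P S' y →
      ∀ m : ℕ, ∃ U ∈ 𝓝 y, BddAbove ((fun c => ‖iteratedFDeriv ℝ m (orbFamGExt L α ν' a' S') c‖) '' (U ∩ InRegG (slotSign L α) S')) := by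
    intro y hy hyk hyin hPy m
    refine exists_nhds_bddAbove_norm_iteratedFDeriv_orbFamGExt_of_hcSwapAt L α ν' hα hreal hS' ha' hw (show (0 : Fin 3) ≠ 1 by decide) h10.symm
      (fun m' _ => hA (hcSwapAt w 0 1 y) ?_ ?_ ?_ (hP S' w hw y hPy) m')
    · rw [(hcSwapAt_apply_pair w 0 1 y).1, hcSwapAt_apply_self_of_ne w (show (2 : Fin 3) ≠ 0 by decide) (show (2 : Fin 3) ≠ 1 by decide)]
      exact hy
    · rw [(hcSwapAt_apply_pair w 0 1 y).2, (hcSwapAt_apply_pair w 0 1 y).1]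
      exact hyk
    · intro w' hw' hne i' j' hij' hs'
      rw [hcSwapAt_apply_of_ne hne]
      exact hyin w' hw' hne i' j' hij' hs'
  -- the six ordered pairs
  have hi : i = 0 ∨ i = 1 ∨ i = 2 := by fin_cases i <;> simp
  have hj : j = 0 ∨ j = 1 ∨ j = 2 := by fin_cases j <;> simp
  rcases hi with rfl | rfl | rfl <;> rcases hj with rfl | rfl | rfl
  · exact absurd rfl hij
  · exact absurd h10.symm hsij
  · exact hA x hx (by simpa only [hcThird_zero_two] using hxk) hxin hPx n
  · exact absurd h10 hsij
  · exact absurd rfl hij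
  · exact hB x hx (by simpa only [hcThird_one_two] using hxk) hxin hPx n
  · refine hA x hx.symm ?_ hxin hPx n
    have h3 : hcThird (2 : Fin 3) 0 = 1 := by decide
    rw [h3, hx] at hxk
    exact hxk
  · refine hB x hx.symm ?_ hxin hPx n
    have h3 : hcThird (2 : Fin 3) 1 = 0 := by decide
    rw [h3, hx] at hxk
    exact hxk
  · exact absurd rfl hij

/-! ## §2 (F₀)+(F′-a): the faces off the real walls, hypothesis-free -/

/-- **(I₁) AT THE FACES OFF THE REAL WALLS — HYPOTHESIS-FREE, IN THE LEAF'S FRAME.**  For a house frame (`hherm`, `hanis`) and `a′ ∈ C_c^∞(G′_∞)`: at EVERY label `S′`,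
every compact-chart place `w ∉ S′`, every noncompact pair `(i, j)`, every one-wall point `x` of the wall `(w, i, j)` (third eigenvalue off, the other compact-chart places
in-regular) WHOSE SPLIT COORDINATES ARE OFF THEIR REAL WALLS (`∀ w′ ∈ S′, x w′ 0 ≠ 0`) and every order `n`: `∃ U ∈ 𝓝 x, BddAbove (‖Dⁿ(orbFamGExt ν′ a′ S′)‖ '' (U ∩ InRegG (slotSign α) S′))`
— the body of the leaf's `HcFaceJetBoundsStatement` with that one extra hypothesis (the cube hypothesis is carried, unused).  §1 with `P S′ x :≡ ∀ w′ ∈ S′, x w′ 0 ≠ 0` (the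
reflection `hcSwapAt w 0 1`, `w ∉ S′`, does not move the split coordinates) over ★ `…_of_boxPackage` ∘ ★ `…_of_corePackage` ∘ ★ (H-core) PART 1
`exists_descent_box_orbFamG_corePackage_of_wall_inRegAt`; carrier and Haar measure inside (★ `sharedRankOneDatum_exists`).
[cite: Varadarajan1977, Part I §1.12] [cite: Bouaziz1994IntegralesOrbitales, §3.1 (I₁)–(I₂) p. 579; §3.2 p. 580] [cite: Shelstad1979, §4 pp. 22–25] [cite: Rogawski1990, §8.2 pp. 118–124] -/
theorem faceJetBounds_offRealWalls
    (hherm : ((Matrix.diagonal α).map (cmConjRingHom L)).transpose = Matrix.diagonal α)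
    (hanis : ∀ x : Fin 3 → L, Literature.AlgebraicGeometry.ShimuraVarieties.hermForm (cmConjRingHom L) (Matrix.diagonal α) x x = 0 → x = 0)
    {a' : ↥(arch (↥(maximalRealSubfield L)) L (IsCMField.complexConj L) 3 (Matrix.diagonal α)) → ℂ} (ha' : ArchSmooth L 3 (Matrix.diagonal α) a') :
    ∀ (S' : Finset {w : InfinitePlace L // IsComplex w}) (n : ℕ) (x : {w : InfinitePlace L // IsComplex w} → Fin 3 → ℝ) (w : {w : InfinitePlace L // IsComplex w}) (i j : Fin 3),
      (∀ w' : {w : InfinitePlace L // IsComplex w}, w' ∉ S' → ∀ l : Fin 3, x w' l ∈ Ico 0 (2 * π)) →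
      w ∉ S' → i ≠ j → slotSign L α w i ≠ slotSign L α w j → x w i = x w j →
        Circle.exp (x w (hcThird i j)) ≠ Circle.exp (x w i) →
        (∀ w', w' ∉ S' → w' ≠ w → ∀ i' j' : Fin 3, i' ≠ j' → slotSign L α w' i' ≠ slotSign L α w' j' → Circle.exp (x w' i') ≠ Circle.exp (x w' j')) →
        (∀ w' : {w : InfinitePlace L // IsComplex w}, w' ∈ S' → x w' 0 ≠ 0) →
        ∃ U ∈ 𝓝 x, BddAbove ((fun c => ‖iteratedFDeriv ℝ n (orbFamGExt L α ν' a' S') c‖) '' (U ∩ InRegG (slotSign L α) S')) := by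
  -- the frame
  have hα : ∀ i, α i ≠ 0 := ne_zero_of_diagonal_anisotropic hanis
  have hreal : ∀ (w' : {w : InfinitePlace L // IsComplex w}) (i : Fin 3), (w'.1.embedding (α i)).im = 0 :=
    im_embedding_diagonal_eq_zero L 3 α (complexConj_apply_eq_of_diagonal_frame hherm)
  -- the standard rank-one Cayley carrier `U(J)` with a two-sided Haar measure
  obtain ⟨J, hJ⟩ : ∃ J : Matrix (Fin 2) (Fin 2) ℂ, J = (StdForm.antidiagonal 2).over ℂ := ⟨_, rfl⟩
  letI : MeasurableSpace ↥(unitaryGroupOfForm (starRingEnd ℂ) J) := borel _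
  haveI : BorelSpace ↥(unitaryGroupOfForm (starRingEnd ℂ) J) := ⟨rfl⟩
  haveI : LocallyCompactSpace ↥(unitaryGroupOfForm (starRingEnd ℂ) J) := locallyCompactSpace_unitaryGroupOfForm_complex J
  haveI : SecondCountableTopology ↥(unitaryGroupOfForm (starRingEnd ℂ) J) := secondCountableTopology_unitaryGroupOfForm_complex J
  letI : MeasurableSpace (↥(unitaryGroupOfForm (starRingEnd ℂ) J) ⧸ torusU (starRingEnd ℂ) J) := borel _
  haveI : BorelSpace (↥(unitaryGroupOfForm (starRingEnd ℂ) J) ⧸ torusU (starRingEnd ℂ) J) := ⟨rfl⟩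
  obtain ⟨μ₀, hμ₀H, hμ₀R, -⟩ := sharedRankOneDatum_exists hJ
  haveI := hμ₀H
  haveI := hμ₀R
  refine faceJetBounds_of_wall02_of_invariant L α ν' hα hreal ha' (fun S' x => ∀ w' : {w : InfinitePlace L // IsComplex w}, w' ∈ S' → x w' 0 ≠ 0)
    (fun S' w hw x hx w' hw' => ?_) ?_
  · rw [hcSwapAt_apply_of_ne (ne_of_mem_of_not_mem hw' hw)]
    exact hx w' hw'
  · intro S' hS' n x w hw hs hx hxk hxin hxS
    have hwsp : w ∈ splitChartPlaces L α :=
      mem_splitChartPlaces_of_isIndefiniteAt L α hα (hreal w) fun hdef => hs (hdef.1.trans hdef.2)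
    exact exists_nhds_bddAbove_norm_iteratedFDeriv_orbFamGExt_of_boxPackage L α ν' hJ μ₀ hw hs hx hxk hxin
      (exists_descent_box_orbFamGExt_inRegG_of_corePackage L α ν' hJ μ₀
        (exists_descent_box_orbFamG_corePackage_of_wall_inRegAt L α ν' hα hreal hJ μ₀ hS' hw hwsp (by rw [hx]) (by rwa [hcThird_zero_two] at hxk) hxin hxS ha')) n

/-! ## §3 EDITION 2 — THE TWO-HALVES CUT (LH3-plan (g4) WORD 11:25:13Z): `hbox = hboxOff ⊕ hboxOn`, and O-L1c modulo the ONE statement `hboxOn` -/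

/-- **O-L1c FROM THE TWO HALVES OF THE (B-desc′) HEAD** (LH3-plan (g4) WORD 11:25:13Z): ★ `faceJetBounds_of_boxDescent_frame` with its `hbox` split by
`by_cases ∀ w′ ∈ S, x w′ 0 ≠ 0` into `hboxOff` (split coordinates off their real walls — ★ p851255 `exists_descent_box_orbFamGExt_inRegG_of_wall_inRegAt`, LH5-p02 (g4)) and
`hboxOn` (some split coordinate ON its real wall — the (F′-b) chain L1 LH1-p03 → L2 F0P3b-p01 → L3 LH5-p02).  Both halves quantify over the Cayley carrier like `hbox`.
[cite: Varadarajan1977, Part I §1.12] [cite: Bouaziz1994IntegralesOrbitales, §3.1 (I₁)–(I₂) p. 579; §3.2 p. 580] [cite: Shelstad1979, §4 pp. 22–25] [cite: Rogawski1990, §8.2 pp. 118–124] -/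
theorem faceJetBounds_of_boxDescent_frame₂
    (hherm : ((Matrix.diagonal α).map (cmConjRingHom L)).transpose = Matrix.diagonal α)
    (hanis : ∀ x : Fin 3 → L, Literature.AlgebraicGeometry.ShimuraVarieties.hermForm (cmConjRingHom L) (Matrix.diagonal α) x x = 0 → x = 0)
    {a' : ↥(arch (↥(maximalRealSubfield L)) L (IsCMField.complexConj L) 3 (Matrix.diagonal α)) → ℂ} (ha' : ArchSmooth L 3 (Matrix.diagonal α) a')
    (hboxOff : ∀ {J : Matrix (Fin 2) (Fin 2) ℂ} (hJ : J = (StdForm.antidiagonal 2).over ℂ)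
      [MeasurableSpace ↥(unitaryGroupOfForm (starRingEnd ℂ) J)] [BorelSpace ↥(unitaryGroupOfForm (starRingEnd ℂ) J)] [LocallyCompactSpace ↥(unitaryGroupOfForm (starRingEnd ℂ) J)] [SecondCountableTopology ↥(unitaryGroupOfForm (starRingEnd ℂ) J)]
      (μ₀ : Measure ↥(unitaryGroupOfForm (starRingEnd ℂ) J)) [μ₀.IsHaarMeasure] [μ₀.IsMulRightInvariant],
      ∀ (S : Finset {w : InfinitePlace L // IsComplex w}), (∀ w, w ∈ S → w ∈ splitChartPlaces L α) → ∀ (w₀ : {w : InfinitePlace L // IsComplex w}), w₀ ∉ S → w₀ ∈ splitChartPlaces L α →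
      ∀ (x : {w : InfinitePlace L // IsComplex w} → Fin 3 → ℝ), x w₀ 0 = x w₀ 2 → Circle.exp (x w₀ 1) ≠ Circle.exp (x w₀ 0) →
      (∀ w', w' ∉ S → w' ≠ w₀ → ∀ i' j' : Fin 3, i' ≠ j' → slotSign L α w' i' ≠ slotSign L α w' j' → Circle.exp (x w' i') ≠ Circle.exp (x w' j')) →
      (∀ w' : {w : InfinitePlace L // IsComplex w}, w' ∈ S → x w' 0 ≠ 0) →
      ∃ (K : ℂ) (U : Set ({w : InfinitePlace L // IsComplex w} → Fin 3 → ℝ)) (f : ({w : InfinitePlace L // IsComplex w} → Fin 3 → ℝ) × Matrix (Fin 2) (Fin 2) ℂ → ℂ),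
      K ≠ 0 ∧ IsOpen U ∧ x ∈ U ∧ ContDiff ℝ ∞ f ∧
      (∃ C : Set (Matrix (Fin 2) (Fin 2) ℂ), IsCompact C ∧ ∀ c X, X ∉ C → f (c, X) = 0) ∧
      (∀ c X, f (c, X) = f (Function.update c w₀ ![0, c w₀ 1, 0], X)) ∧
      (∀ c ∈ U, Circle.exp (c w₀ 0) ≠ Circle.exp (c w₀ 2) → c ∈ InRegG (slotSign L α) S) ∧
      ∀ c ∈ U, Circle.exp (c w₀ 0) ≠ Circle.exp (c w₀ 2) →
        orbFamGExt L α ν' a' S c =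
          (1 - (Circle.exp (c w₀ 1 - c w₀ 0) : ℂ)) * (1 - (Circle.exp (c w₀ 2 - c w₀ 0) : ℂ)) * (1 - (Circle.exp (c w₀ 2 - c w₀ 1) : ℂ)) *
          (K * ∫ h : ↥(unitaryGroupOfForm (starRingEnd ℂ) J),
            f (c, (((h * ⟨Matrix.GeneralLinearGroup.mkOfDetNeZero !![(1 : ℂ), 1; 1, -1] det_cayleyTwo_ne_zero *
                  circleDiagonal 2 ![Circle.exp (c w₀ 0), Circle.exp (c w₀ 2)] *
                  (Matrix.GeneralLinearGroup.mkOfDetNeZero !![(1 : ℂ), 1; 1, -1] det_cayleyTwo_ne_zero)⁻¹,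
                cayley_conj_circleDiagonal_mem_of_eq_over hJ _⟩ * h⁻¹ : ↥(unitaryGroupOfForm (starRingEnd ℂ) J)) : GL (Fin 2) ℂ) : Matrix (Fin 2) (Fin 2) ℂ)) ∂μ₀))
    (hboxOn : ∀ {J : Matrix (Fin 2) (Fin 2) ℂ} (hJ : J = (StdForm.antidiagonal 2).over ℂ)
      [MeasurableSpace ↥(unitaryGroupOfForm (starRingEnd ℂ) J)] [BorelSpace ↥(unitaryGroupOfForm (starRingEnd ℂ) J)] [LocallyCompactSpace ↥(unitaryGroupOfForm (starRingEnd ℂ) J)] [SecondCountableTopology ↥(unitaryGroupOfForm (starRingEnd ℂ) J)]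
      (μ₀ : Measure ↥(unitaryGroupOfForm (starRingEnd ℂ) J)) [μ₀.IsHaarMeasure] [μ₀.IsMulRightInvariant],
      ∀ (S : Finset {w : InfinitePlace L // IsComplex w}), (∀ w, w ∈ S → w ∈ splitChartPlaces L α) → ∀ (w₀ : {w : InfinitePlace L // IsComplex w}), w₀ ∉ S → w₀ ∈ splitChartPlaces L α →
      ∀ (x : {w : InfinitePlace L // IsComplex w} → Fin 3 → ℝ), x w₀ 0 = x w₀ 2 → Circle.exp (x w₀ 1) ≠ Circle.exp (x w₀ 0) →
      (∀ w', w' ∉ S → w' ≠ w₀ → ∀ i' j' : Fin 3, i' ≠ j' → slotSign L α w' i' ≠ slotSign L α w' j' → Circle.exp (x w' i') ≠ Circle.exp (x w' j')) →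
      (∃ w' : {w : InfinitePlace L // IsComplex w}, w' ∈ S ∧ x w' 0 = 0) →
      ∃ (K : ℂ) (U : Set ({w : InfinitePlace L // IsComplex w} → Fin 3 → ℝ)) (f : ({w : InfinitePlace L // IsComplex w} → Fin 3 → ℝ) × Matrix (Fin 2) (Fin 2) ℂ → ℂ),
      K ≠ 0 ∧ IsOpen U ∧ x ∈ U ∧ ContDiff ℝ ∞ f ∧
      (∃ C : Set (Matrix (Fin 2) (Fin 2) ℂ), IsCompact C ∧ ∀ c X, X ∉ C → f (c, X) = 0) ∧
      (∀ c X, f (c, X) = f (Function.update c w₀ ![0, c w₀ 1, 0], X)) ∧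
      (∀ c ∈ U, Circle.exp (c w₀ 0) ≠ Circle.exp (c w₀ 2) → c ∈ InRegG (slotSign L α) S) ∧
      ∀ c ∈ U, Circle.exp (c w₀ 0) ≠ Circle.exp (c w₀ 2) →
        orbFamGExt L α ν' a' S c =
          (1 - (Circle.exp (c w₀ 1 - c w₀ 0) : ℂ)) * (1 - (Circle.exp (c w₀ 2 - c w₀ 0) : ℂ)) * (1 - (Circle.exp (c w₀ 2 - c w₀ 1) : ℂ)) *
          (K * ∫ h : ↥(unitaryGroupOfForm (starRingEnd ℂ) J),
            f (c, (((h * ⟨Matrix.GeneralLinearGroup.mkOfDetNeZero !![(1 : ℂ), 1; 1, -1] det_cayleyTwo_ne_zero *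
                  circleDiagonal 2 ![Circle.exp (c w₀ 0), Circle.exp (c w₀ 2)] *
                  (Matrix.GeneralLinearGroup.mkOfDetNeZero !![(1 : ℂ), 1; 1, -1] det_cayleyTwo_ne_zero)⁻¹,
                cayley_conj_circleDiagonal_mem_of_eq_over hJ _⟩ * h⁻¹ : ↥(unitaryGroupOfForm (starRingEnd ℂ) J)) : GL (Fin 2) ℂ) : Matrix (Fin 2) (Fin 2) ℂ)) ∂μ₀)) :
    ∀ (S' : Finset {w : InfinitePlace L // IsComplex w}) (n : ℕ) (x : {w : InfinitePlace L // IsComplex w} → Fin 3 → ℝ) (w : {w : InfinitePlace L // IsComplex w}) (i j : Fin 3),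
      (∀ w' : {w : InfinitePlace L // IsComplex w}, w' ∉ S' → ∀ l : Fin 3, x w' l ∈ Ico 0 (2 * π)) →
      w ∉ S' → i ≠ j → slotSign L α w i ≠ slotSign L α w j → x w i = x w j →
        Circle.exp (x w (hcThird i j)) ≠ Circle.exp (x w i) →
        (∀ w', w' ∉ S' → w' ≠ w → ∀ i' j' : Fin 3, i' ≠ j' → slotSign L α w' i' ≠ slotSign L α w' j' → Circle.exp (x w' i') ≠ Circle.exp (x w' j')) →
        ∃ U ∈ 𝓝 x, BddAbove ((fun c => ‖iteratedFDeriv ℝ n (orbFamGExt L α ν' a' S') c‖) '' (U ∩ InRegG (slotSign L α) S')) := by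
  refine faceJetBounds_of_boxDescent_frame L α ν' hherm hanis ha' ?_
  intro J hJ _ _ _ _ μ₀ _ _ S hS w₀ hw₀ hwsp x hx02 hx1 hxin
  by_cases h : ∀ w' : {w : InfinitePlace L // IsComplex w}, w' ∈ S → x w' 0 ≠ 0
  · exact hboxOff hJ μ₀ S hS w₀ hw₀ hwsp x hx02 hx1 hxin h
  · push Not at h
    exact hboxOn hJ μ₀ S hS w₀ hw₀ hwsp x hx02 hx1 hxin h

/-- **O-L1c MODULO THE ONE STATEMENT `hboxOn`** (the (F′-b) head «one noncompact wall × a real wall»): the OFF half of the (B-desc′) head is ★ p851255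
`exists_descent_box_orbFamGExt_inRegG_of_wall_inRegAt` (LH5-p02 (g4)), consumed here; the whole `hF` text of ★ `smoothBounded_orbFamGExt_of_strata₄` (= the body of the leaf's
`HcFaceJetBoundsStatement`) follows from `hboxOn` ALONE.  The leaf pays O-L1c by `fun L _ _ _ α _ _ ν' _ _ hherm hanis a' ha' => faceJetBounds_of_boxDescentOn L α ν' hherm hanis ha' ‹hboxOn›`.
[cite: Varadarajan1977, Part I §1.12] [cite: Bouaziz1994IntegralesOrbitales, §3.1 (I₁)–(I₂) p. 579; §3.2 p. 580] [cite: Shelstad1979, §4 pp. 22–25] [cite: Rogawski1990, §8.2 pp. 118–124] -/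
theorem faceJetBounds_of_boxDescentOn
    (hherm : ((Matrix.diagonal α).map (cmConjRingHom L)).transpose = Matrix.diagonal α)
    (hanis : ∀ x : Fin 3 → L, Literature.AlgebraicGeometry.ShimuraVarieties.hermForm (cmConjRingHom L) (Matrix.diagonal α) x x = 0 → x = 0)
    {a' : ↥(arch (↥(maximalRealSubfield L)) L (IsCMField.complexConj L) 3 (Matrix.diagonal α)) → ℂ} (ha' : ArchSmooth L 3 (Matrix.diagonal α) a')
    (hboxOn : ∀ {J : Matrix (Fin 2) (Fin 2) ℂ} (hJ : J = (StdForm.antidiagonal 2).over ℂ)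
      [MeasurableSpace ↥(unitaryGroupOfForm (starRingEnd ℂ) J)] [BorelSpace ↥(unitaryGroupOfForm (starRingEnd ℂ) J)] [LocallyCompactSpace ↥(unitaryGroupOfForm (starRingEnd ℂ) J)] [SecondCountableTopology ↥(unitaryGroupOfForm (starRingEnd ℂ) J)]
      (μ₀ : Measure ↥(unitaryGroupOfForm (starRingEnd ℂ) J)) [μ₀.IsHaarMeasure] [μ₀.IsMulRightInvariant],
      ∀ (S : Finset {w : InfinitePlace L // IsComplex w}), (∀ w, w ∈ S → w ∈ splitChartPlaces L α) → ∀ (w₀ : {w : InfinitePlace L // IsComplex w}), w₀ ∉ S → w₀ ∈ splitChartPlaces L α →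
      ∀ (x : {w : InfinitePlace L // IsComplex w} → Fin 3 → ℝ), x w₀ 0 = x w₀ 2 → Circle.exp (x w₀ 1) ≠ Circle.exp (x w₀ 0) →
      (∀ w', w' ∉ S → w' ≠ w₀ → ∀ i' j' : Fin 3, i' ≠ j' → slotSign L α w' i' ≠ slotSign L α w' j' → Circle.exp (x w' i') ≠ Circle.exp (x w' j')) →
      (∃ w' : {w : InfinitePlace L // IsComplex w}, w' ∈ S ∧ x w' 0 = 0) →
      ∃ (K : ℂ) (U : Set ({w : InfinitePlace L // IsComplex w} → Fin 3 → ℝ)) (f : ({w : InfinitePlace L // IsComplex w} → Fin 3 → ℝ) × Matrix (Fin 2) (Fin 2) ℂ → ℂ),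
      K ≠ 0 ∧ IsOpen U ∧ x ∈ U ∧ ContDiff ℝ ∞ f ∧
      (∃ C : Set (Matrix (Fin 2) (Fin 2) ℂ), IsCompact C ∧ ∀ c X, X ∉ C → f (c, X) = 0) ∧
      (∀ c X, f (c, X) = f (Function.update c w₀ ![0, c w₀ 1, 0], X)) ∧
      (∀ c ∈ U, Circle.exp (c w₀ 0) ≠ Circle.exp (c w₀ 2) → c ∈ InRegG (slotSign L α) S) ∧
      ∀ c ∈ U, Circle.exp (c w₀ 0) ≠ Circle.exp (c w₀ 2) →
        orbFamGExt L α ν' a' S c =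
          (1 - (Circle.exp (c w₀ 1 - c w₀ 0) : ℂ)) * (1 - (Circle.exp (c w₀ 2 - c w₀ 0) : ℂ)) * (1 - (Circle.exp (c w₀ 2 - c w₀ 1) : ℂ)) *
          (K * ∫ h : ↥(unitaryGroupOfForm (starRingEnd ℂ) J),
            f (c, (((h * ⟨Matrix.GeneralLinearGroup.mkOfDetNeZero !![(1 : ℂ), 1; 1, -1] det_cayleyTwo_ne_zero *
                  circleDiagonal 2 ![Circle.exp (c w₀ 0), Circle.exp (c w₀ 2)] *
                  (Matrix.GeneralLinearGroup.mkOfDetNeZero !![(1 : ℂ), 1; 1, -1] det_cayleyTwo_ne_zero)⁻¹,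
                cayley_conj_circleDiagonal_mem_of_eq_over hJ _⟩ * h⁻¹ : ↥(unitaryGroupOfForm (starRingEnd ℂ) J)) : GL (Fin 2) ℂ) : Matrix (Fin 2) (Fin 2) ℂ)) ∂μ₀)) :
    ∀ (S' : Finset {w : InfinitePlace L // IsComplex w}) (n : ℕ) (x : {w : InfinitePlace L // IsComplex w} → Fin 3 → ℝ) (w : {w : InfinitePlace L // IsComplex w}) (i j : Fin 3),
      (∀ w' : {w : InfinitePlace L // IsComplex w}, w' ∉ S' → ∀ l : Fin 3, x w' l ∈ Ico 0 (2 * π)) →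
      w ∉ S' → i ≠ j → slotSign L α w i ≠ slotSign L α w j → x w i = x w j →
        Circle.exp (x w (hcThird i j)) ≠ Circle.exp (x w i) →
        (∀ w', w' ∉ S' → w' ≠ w → ∀ i' j' : Fin 3, i' ≠ j' → slotSign L α w' i' ≠ slotSign L α w' j' → Circle.exp (x w' i') ≠ Circle.exp (x w' j')) →
        ∃ U ∈ 𝓝 x, BddAbove ((fun c => ‖iteratedFDeriv ℝ n (orbFamGExt L α ν' a' S') c‖) '' (U ∩ InRegG (slotSign L α) S')) := by
  have hα : ∀ i, α i ≠ 0 := ne_zero_of_diagonal_anisotropic hanis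
  have hreal : ∀ (w' : {w : InfinitePlace L // IsComplex w}) (i : Fin 3), (w'.1.embedding (α i)).im = 0 :=
    im_embedding_diagonal_eq_zero L 3 α (complexConj_apply_eq_of_diagonal_frame hherm)
  refine faceJetBounds_of_boxDescent_frame₂ L α ν' hherm hanis ha' ?_ hboxOn
  intro J hJ _ _ _ _ μ₀ _ _ S hS w₀ hw₀ hwsp x hx02 hx1 hxin hxS
  exact exists_descent_box_orbFamGExt_inRegG_of_wall_inRegAt L α ν' hα hreal hJ μ₀ hS hw₀ hwsp (by rw [hx02]) hx1 hxin hxS ha'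

/-! ## §4 EDITION 3 — O-L1c-b's OWN socket: the leaf v6 `HcFaceJetBoundsOnRealWallStatement` from `hboxOn` alone -/

/-- **O-L1c-b «FACE × A REAL WALL» FROM `hboxOn` ALONE, IN THE LEAF'S FRAME (EDITION 3).**  The body of the leaf v6 organ `HcFaceJetBoundsOnRealWallStatement` — the `hF` text
with the ONE clause `(∃ w′, w′ ∈ S′ ∧ x w′ 0 = 0)` appended last (LH3-plan (g4) 11:29:08Z) — follows from the ON half `hboxOn` of the (B-desc′) head alone: §1
`faceJetBounds_of_wall02_of_invariant` with the reflection-invariant property `P S′ x :≡ ∃ w′ ∈ S′, x w′ 0 = 0` (the compact reflection `hcSwapAt w 0 1`, `w ∉ S′`, does not move the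
split coordinates) over ★ `…_of_boxPackage`, carrier and Haar measure inside.  So LH5-p02 (g4)'s L3 head (the 8-clause package at the real-wall one-wall points) pays the leaf's
`stub_N9hcFaceJetBoundsOnRealWall` by `fun L _ _ _ α _ _ ν' _ _ hherm hanis _ ha' => faceJetBounds_onRealWall_of_boxDescentOn L α ν' hherm hanis ha' ‹L3 head›`.
[cite: Varadarajan1977, Part I §1.12] [cite: Bouaziz1994IntegralesOrbitales, §3.1 (I₁)–(I₂) p. 579; §3.2 p. 580] [cite: Shelstad1979, §4 pp. 22–25] [cite: Rogawski1990, §8.2 pp. 118–124] -/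
theorem faceJetBounds_onRealWall_of_boxDescentOn
    (hherm : ((Matrix.diagonal α).map (cmConjRingHom L)).transpose = Matrix.diagonal α)
    (hanis : ∀ x : Fin 3 → L, Literature.AlgebraicGeometry.ShimuraVarieties.hermForm (cmConjRingHom L) (Matrix.diagonal α) x x = 0 → x = 0)
    {a' : ↥(arch (↥(maximalRealSubfield L)) L (IsCMField.complexConj L) 3 (Matrix.diagonal α)) → ℂ} (ha' : ArchSmooth L 3 (Matrix.diagonal α) a')
    (hboxOn : ∀ {J : Matrix (Fin 2) (Fin 2) ℂ} (hJ : J = (StdForm.antidiagonal 2).over ℂ)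
      [MeasurableSpace ↥(unitaryGroupOfForm (starRingEnd ℂ) J)] [BorelSpace ↥(unitaryGroupOfForm (starRingEnd ℂ) J)] [LocallyCompactSpace ↥(unitaryGroupOfForm (starRingEnd ℂ) J)] [SecondCountableTopology ↥(unitaryGroupOfForm (starRingEnd ℂ) J)]
      (μ₀ : Measure ↥(unitaryGroupOfForm (starRingEnd ℂ) J)) [μ₀.IsHaarMeasure] [μ₀.IsMulRightInvariant],
      ∀ (S : Finset {w : InfinitePlace L // IsComplex w}), (∀ w, w ∈ S → w ∈ splitChartPlaces L α) → ∀ (w₀ : {w : InfinitePlace L // IsComplex w}), w₀ ∉ S → w₀ ∈ splitChartPlaces L α →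
      ∀ (x : {w : InfinitePlace L // IsComplex w} → Fin 3 → ℝ), x w₀ 0 = x w₀ 2 → Circle.exp (x w₀ 1) ≠ Circle.exp (x w₀ 0) →
      (∀ w', w' ∉ S → w' ≠ w₀ → ∀ i' j' : Fin 3, i' ≠ j' → slotSign L α w' i' ≠ slotSign L α w' j' → Circle.exp (x w' i') ≠ Circle.exp (x w' j')) →
      (∃ w' : {w : InfinitePlace L // IsComplex w}, w' ∈ S ∧ x w' 0 = 0) →
      ∃ (K : ℂ) (U : Set ({w : InfinitePlace L // IsComplex w} → Fin 3 → ℝ)) (f : ({w : InfinitePlace L // IsComplex w} → Fin 3 → ℝ) × Matrix (Fin 2) (Fin 2) ℂ → ℂ),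
      K ≠ 0 ∧ IsOpen U ∧ x ∈ U ∧ ContDiff ℝ ∞ f ∧
      (∃ C : Set (Matrix (Fin 2) (Fin 2) ℂ), IsCompact C ∧ ∀ c X, X ∉ C → f (c, X) = 0) ∧
      (∀ c X, f (c, X) = f (Function.update c w₀ ![0, c w₀ 1, 0], X)) ∧
      (∀ c ∈ U, Circle.exp (c w₀ 0) ≠ Circle.exp (c w₀ 2) → c ∈ InRegG (slotSign L α) S) ∧
      ∀ c ∈ U, Circle.exp (c w₀ 0) ≠ Circle.exp (c w₀ 2) →
        orbFamGExt L α ν' a' S c =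
          (1 - (Circle.exp (c w₀ 1 - c w₀ 0) : ℂ)) * (1 - (Circle.exp (c w₀ 2 - c w₀ 0) : ℂ)) * (1 - (Circle.exp (c w₀ 2 - c w₀ 1) : ℂ)) *
          (K * ∫ h : ↥(unitaryGroupOfForm (starRingEnd ℂ) J),
            f (c, (((h * ⟨Matrix.GeneralLinearGroup.mkOfDetNeZero !![(1 : ℂ), 1; 1, -1] det_cayleyTwo_ne_zero *
                  circleDiagonal 2 ![Circle.exp (c w₀ 0), Circle.exp (c w₀ 2)] *
                  (Matrix.GeneralLinearGroup.mkOfDetNeZero !![(1 : ℂ), 1; 1, -1] det_cayleyTwo_ne_zero)⁻¹,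
                cayley_conj_circleDiagonal_mem_of_eq_over hJ _⟩ * h⁻¹ : ↥(unitaryGroupOfForm (starRingEnd ℂ) J)) : GL (Fin 2) ℂ) : Matrix (Fin 2) (Fin 2) ℂ)) ∂μ₀)) :
    ∀ (S' : Finset {w : InfinitePlace L // IsComplex w}) (n : ℕ) (x : {w : InfinitePlace L // IsComplex w} → Fin 3 → ℝ) (w : {w : InfinitePlace L // IsComplex w}) (i j : Fin 3),
      (∀ w' : {w : InfinitePlace L // IsComplex w}, w' ∉ S' → ∀ l : Fin 3, x w' l ∈ Ico 0 (2 * π)) →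
      w ∉ S' → i ≠ j → slotSign L α w i ≠ slotSign L α w j → x w i = x w j →
        Circle.exp (x w (hcThird i j)) ≠ Circle.exp (x w i) →
        (∀ w', w' ∉ S' → w' ≠ w → ∀ i' j' : Fin 3, i' ≠ j' → slotSign L α w' i' ≠ slotSign L α w' j' → Circle.exp (x w' i') ≠ Circle.exp (x w' j')) →
        (∃ w' : {w : InfinitePlace L // IsComplex w}, w' ∈ S' ∧ x w' 0 = 0) →
        ∃ U ∈ 𝓝 x, BddAbove ((fun c => ‖iteratedFDeriv ℝ n (orbFamGExt L α ν' a' S') c‖) '' (U ∩ InRegG (slotSign L α) S')) := by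
  -- the frame
  have hα : ∀ i, α i ≠ 0 := ne_zero_of_diagonal_anisotropic hanis
  have hreal : ∀ (w' : {w : InfinitePlace L // IsComplex w}) (i : Fin 3), (w'.1.embedding (α i)).im = 0 :=
    im_embedding_diagonal_eq_zero L 3 α (complexConj_apply_eq_of_diagonal_frame hherm)
  -- the standard rank-one Cayley carrier `U(J)` with a two-sided Haar measure
  obtain ⟨J, hJ⟩ : ∃ J : Matrix (Fin 2) (Fin 2) ℂ, J = (StdForm.antidiagonal 2).over ℂ := ⟨_, rfl⟩
  letI : MeasurableSpace ↥(unitaryGroupOfForm (starRingEnd ℂ) J) := borel _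
  haveI : BorelSpace ↥(unitaryGroupOfForm (starRingEnd ℂ) J) := ⟨rfl⟩
  haveI : LocallyCompactSpace ↥(unitaryGroupOfForm (starRingEnd ℂ) J) := locallyCompactSpace_unitaryGroupOfForm_complex J
  haveI : SecondCountableTopology ↥(unitaryGroupOfForm (starRingEnd ℂ) J) := secondCountableTopology_unitaryGroupOfForm_complex J
  letI : MeasurableSpace (↥(unitaryGroupOfForm (starRingEnd ℂ) J) ⧸ torusU (starRingEnd ℂ) J) := borel _
  haveI : BorelSpace (↥(unitaryGroupOfForm (starRingEnd ℂ) J) ⧸ torusU (starRingEnd ℂ) J) := ⟨rfl⟩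
  obtain ⟨μ₀, hμ₀H, hμ₀R, -⟩ := sharedRankOneDatum_exists hJ
  haveI := hμ₀H
  haveI := hμ₀R
  refine faceJetBounds_of_wall02_of_invariant L α ν' hα hreal ha' (fun S' x => ∃ w' : {w : InfinitePlace L // IsComplex w}, w' ∈ S' ∧ x w' 0 = 0)
    (fun S' w hw x hx => ?_) ?_
  · obtain ⟨w', hw', h0⟩ := hx
    exact ⟨w', hw', by rw [hcSwapAt_apply_of_ne (ne_of_mem_of_not_mem hw' hw)]; exact h0⟩
  · intro S' hS' n x w hw hs hx hxk hxin hxS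
    have hwsp : w ∈ splitChartPlaces L α :=
      mem_splitChartPlaces_of_isIndefiniteAt L α hα (hreal w) fun hdef => hs (hdef.1.trans hdef.2)
    exact exists_nhds_bddAbove_norm_iteratedFDeriv_orbFamGExt_of_boxPackage L α ν' hJ μ₀ hw hs hx hxk hxin
      (hboxOn hJ μ₀ S' hS' w hw hwsp x hx (by rwa [hcThird_zero_two] at hxk) hxin hxS) n

/-! ## §5 EDITION 4 — HYPOTHESIS-FREE: O-L1c and O-L1c-b over ★ LH5-p02's head `exists_descent_box_orbFamGExt_inRegG` (all one-wall points) -/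

/-- **(I₁) AT THE FACES — HYPOTHESIS-FREE, IN THE LEAF'S FRAME**: the body of the leaf's `HcFaceJetBoundsStatement` (= the `hF` socket of ★ `smoothBounded_orbFamGExt_of_strata₄`)
for every house frame (`hherm`, `hanis`) and every `a′ ∈ C_c^∞(G′_∞)`: ★ `faceJetBounds_of_boxDescent_frame` over ★ LH5-p02 (g4)'s (B-desc′) head at EVERY one-wall point
`exists_descent_box_orbFamGExt_inRegG` ((H-core) chain L1 ★ p851272 → L2 ★ p851278∕p851293 → L3 ★).
[cite: Varadarajan1977, Part I §1.12] [cite: Bouaziz1994IntegralesOrbitales, §3.1 (I₁)–(I₂) p. 579; §3.2 p. 580] [cite: Shelstad1979, §4 pp. 22–25] [cite: Rogawski1990, §8.2 pp. 118–124] -/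
theorem faceJetBounds
    (hherm : ((Matrix.diagonal α).map (cmConjRingHom L)).transpose = Matrix.diagonal α)
    (hanis : ∀ x : Fin 3 → L, Literature.AlgebraicGeometry.ShimuraVarieties.hermForm (cmConjRingHom L) (Matrix.diagonal α) x x = 0 → x = 0)
    {a' : ↥(arch (↥(maximalRealSubfield L)) L (IsCMField.complexConj L) 3 (Matrix.diagonal α)) → ℂ} (ha' : ArchSmooth L 3 (Matrix.diagonal α) a') :
    ∀ (S' : Finset {w : InfinitePlace L // IsComplex w}) (n : ℕ) (x : {w : InfinitePlace L // IsComplex w} → Fin 3 → ℝ) (w : {w : InfinitePlace L // IsComplex w}) (i j : Fin 3),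
      (∀ w' : {w : InfinitePlace L // IsComplex w}, w' ∉ S' → ∀ l : Fin 3, x w' l ∈ Ico 0 (2 * π)) →
      w ∉ S' → i ≠ j → slotSign L α w i ≠ slotSign L α w j → x w i = x w j →
        Circle.exp (x w (hcThird i j)) ≠ Circle.exp (x w i) →
        (∀ w', w' ∉ S' → w' ≠ w → ∀ i' j' : Fin 3, i' ≠ j' → slotSign L α w' i' ≠ slotSign L α w' j' → Circle.exp (x w' i') ≠ Circle.exp (x w' j')) →
        ∃ U ∈ 𝓝 x, BddAbove ((fun c => ‖iteratedFDeriv ℝ n (orbFamGExt L α ν' a' S') c‖) '' (U ∩ InRegG (slotSign L α) S')) := by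
  have hα : ∀ i, α i ≠ 0 := ne_zero_of_diagonal_anisotropic hanis
  have hreal : ∀ (w' : {w : InfinitePlace L // IsComplex w}) (i : Fin 3), (w'.1.embedding (α i)).im = 0 :=
    im_embedding_diagonal_eq_zero L 3 α (complexConj_apply_eq_of_diagonal_frame hherm)
  refine faceJetBounds_of_boxDescent_frame L α ν' hherm hanis ha' ?_
  intro J hJ _ _ _ _ μ₀ _ _ S hS w₀ hw₀ hwsp x hx02 hx1 hxin
  exact exists_descent_box_orbFamGExt_inRegG L α ν' hα hreal hJ μ₀ hS hw₀ hwsp hx02 hx1 hxin ha'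

/-- **O-L1c-b «FACE × A REAL WALL» — HYPOTHESIS-FREE**: the body of the leaf v6 organ `HcFaceJetBoundsOnRealWallStatement` (the extra clause is simply dropped).
[cite: Varadarajan1977, Part I §1.12] [cite: Bouaziz1994IntegralesOrbitales, §3.1 (I₁)–(I₂) p. 579; §3.2 p. 580] [cite: Shelstad1979, §4 pp. 22–25] [cite: Rogawski1990, §8.2 pp. 118–124] -/
theorem faceJetBounds_onRealWall
    (hherm : ((Matrix.diagonal α).map (cmConjRingHom L)).transpose = Matrix.diagonal α)
    (hanis : ∀ x : Fin 3 → L, Literature.AlgebraicGeometry.ShimuraVarieties.hermForm (cmConjRingHom L) (Matrix.diagonal α) x x = 0 → x = 0)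
    {a' : ↥(arch (↥(maximalRealSubfield L)) L (IsCMField.complexConj L) 3 (Matrix.diagonal α)) → ℂ} (ha' : ArchSmooth L 3 (Matrix.diagonal α) a') :
    ∀ (S' : Finset {w : InfinitePlace L // IsComplex w}) (n : ℕ) (x : {w : InfinitePlace L // IsComplex w} → Fin 3 → ℝ) (w : {w : InfinitePlace L // IsComplex w}) (i j : Fin 3),
      (∀ w' : {w : InfinitePlace L // IsComplex w}, w' ∉ S' → ∀ l : Fin 3, x w' l ∈ Ico 0 (2 * π)) →
      w ∉ S' → i ≠ j → slotSign L α w i ≠ slotSign L α w j → x w i = x w j →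
        Circle.exp (x w (hcThird i j)) ≠ Circle.exp (x w i) →
        (∀ w', w' ∉ S' → w' ≠ w → ∀ i' j' : Fin 3, i' ≠ j' → slotSign L α w' i' ≠ slotSign L α w' j' → Circle.exp (x w' i') ≠ Circle.exp (x w' j')) →
        (∃ w' : {w : InfinitePlace L // IsComplex w}, w' ∈ S' ∧ x w' 0 = 0) →
        ∃ U ∈ 𝓝 x, BddAbove ((fun c => ‖iteratedFDeriv ℝ n (orbFamGExt L α ν' a' S') c‖) '' (U ∩ InRegG (slotSign L α) S')) :=
  fun S' n x w i j hcube hw hij hs hx hxk hxin _ => faceJetBounds L α ν' hherm hanis ha' S' n x w i j hcube hw hij hs hx hxk hxin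

end Literature.NumberTheory.Rogawski1990

end
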